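import Mathlib
import Summits.CriticalPhenomena.CardyFormulaZ2.Theorems.CardyMagicRigidityDefs
import Summits.CriticalPhenomena.CardyFormulaZ2.Theorems.CardyMagicRigidityPositiveConeDefs
import Summits.CriticalPhenomena.CardyFormulaZ2.Theorems.CardyMagicRigidityNestingRigidityPrecompactnessLimitSamples
import Summits.CriticalPhenomena.CardyFormulaZ2.Theorems.CardyMagicRigidityNestingRigidityPrecompactnessLocallyFinite
import Summits.CriticalPhenomena.CardyFormulaZ2.Theorems.CardyMagicRigidityNestingRigidityPrecompactnessFullSequence
import Literature.Probability.RandomPlanarGeometry.LocFinLoopConfig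
import HarnessLib

/-!
# Stub `stub_precompactness`, regular limits: assembly of the regular modification from two a.s. properties

Crux `Summit.CriticalPhenomena.CardyFormulaZ2.Theses.CardyMagicRigidity.NestingRigidity`
(stmt-CriticalPhenomena-4835), line `positive-cone-weight-doubling`, registered stub `stub_precompactness :
PrecompactRegular zEns ∧ PrecompactRegular tEns`.  By the reduction files (`…PrecompactnessReduction` p128809,
`…PrecompactnessFullSequence` p129294) the stub is T1m (pure `d_CN`-precompactness with measurable exceptional
events) + T2m (regular modification of such limit presentations).  Three of the five fields of `Regular` hold a.s.
for EVERY such limit presentation `X` of a lattice ensemble, with no modification: `degreeOne`, `laminar`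
(`ae_degreeOne_laminar_of_tendsto_cnLawEDist`, p129158) and `locallyFinite`
(`ae_isLocallyFinite_of_tendsto_cnLawEDist`).  This file ASSEMBLES T2m from the two remaining fields, stated as
a.s. properties of the NON-TRIVIAL loops of `X s` (point loops are invisible to `d_CN` only up to the small loops
around them, and violate `Regular.boundary`; they are pruned):

* `Precompact.cnEDist_prune_eq_zero` — for the pruned configuration `x⁺ = ⟨fun i ↦ {u ∈ x.F i | u.range.Nontrivial}⟩`
  (non-point members, same types; written inline, no definition), `d_CN(x, x⁺) = 0` as soon as every point loop of `x` is a `udist`-limit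
  of non-point loops of `x` of the same type ("dust": the point loops of a limit presentation sit under the
  microscopic loops);
* `Precompact.regular_prune` — `x⁺` is `Regular` if `x` has `degreeOne`, `laminar` loops, is locally finite,
  and its non-point loops satisfy `boundary` and `separating`;
* `regularModification_of_ae_boundary_separating` (registered anchor) — **T2m for a lattice ensemble from three
  a.s. statements about the limit presentation**: (B) a.s. every non-point loop of `X s` has trace = frontier of its
  winding interior; (S) a.s. two non-point loops of `X s` with the same winding interior coincide up to reversal;
  (D) a.s. every point loop of `X s` is a `udist`-limit of non-point loops of `X s` of its type.  Then
  `X' s := (X s)⁺` is a.e. `Regular` with `d_CN(X s, X' s) = 0` a.e., hence (Lemma L) the same `d_CN`-limit.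

(B) and (S) are the genuinely hard percolation inputs of T2 (no retraced arcs / no "hair"; no two macroscopic
interfaces everywhere `o(1)`-close); (D) follows from RSW density of MESOSCOPIC loops of both types (circuits in
annuli at every scale, cf. `…BondLoopDensity`, `Literature…SiteLoopDensity`) transferred through the couplings —
not done here.
-/

noncomputable section

open MeasureTheory Set Filter Metric
open scoped Real Topology BigOperators ENNReal

namespace Summit.CriticalPhenomena.CardyFormulaZ2.Cruxes.NestingRigidity.PositiveConeWeightDoubling

open Literature.Probability.RandomPlanarGeometry Literature.Probability.Percolation
  Literature.Probability.LatticeModels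
open Summit.CriticalPhenomena.CardyFormulaZ2.Theses.CardyMagicRigidity
open Summit.CriticalPhenomena.CardyFormulaZ2.Cruxes.NestingRigidity.RingCloudTomography

namespace Precompact

/-! ### Pruning point loops

The pruned configuration of `x` is written inline as the structure literal
`⟨fun i ↦ {u ∈ x.F i | u.range.Nontrivial}⟩ : LoopConfig ℂ` (non-point members, same types); no definition is
introduced. -/

/-- Loops of the pruned configuration are loops of the original one. -/
theorem loops_prune_subset (x : LoopConfig ℂ) :
    (⟨fun i ↦ {u ∈ x.F i | u.range.Nontrivial}⟩ : LoopConfig ℂ).loops ⊆ x.loops := by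
  rintro u (hu | hu)
  exacts [Or.inl hu.1, Or.inr hu.1]

/-- Loops of the pruned configuration have non-trivial trace. -/
theorem nontrivial_of_mem_loops_prune {x : LoopConfig ℂ} {u : UnbasedLoop ℂ}
    (hu : u ∈ (⟨fun i ↦ {u ∈ x.F i | u.range.Nontrivial}⟩ : LoopConfig ℂ).loops) : u.range.Nontrivial := by
  rcases hu with hu | hu
  exacts [hu.2, hu.2]

/-- **`d_CN(x, x⁺) = 0` under the dust condition** (`x⁺` the pruned configuration): if every point loop of `x`
is, for every `ε > 0`, within
`udist ≤ ε` of a non-point loop of `x` of the same type, pruning the point loops does not move the configuration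
in `d_CN` (every member of either configuration in any window has an `ε`-close partner in the other). -/
theorem cnEDist_prune_eq_zero {x : LoopConfig ℂ}
    (hdust : ∀ (i : Fin 2), ∀ u ∈ x.F i, ¬ u.range.Nontrivial → ∀ ε : ℝ, 0 < ε →
      ∃ v ∈ x.F i, v.range.Nontrivial ∧ u.udist v ≤ ε) :
    LoopConfig.cnEDist x ⟨fun i ↦ {u ∈ x.F i | u.range.Nontrivial}⟩ = 0 := by
  rw [LoopConfig.cnEDist_eq_zero_iff]
  intro ε hε i
  refine ⟨fun u hu _ ↦ ?_, fun u' hu' _ ↦ ⟨u', hu'.1, by rw [UnbasedLoop.udist_self]; exact hε.le⟩⟩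
  by_cases hnt : u.range.Nontrivial
  · exact ⟨u, ⟨hu, hnt⟩, by rw [UnbasedLoop.udist_self]; exact hε.le⟩
  · obtain ⟨v, hv, hvnt, hd⟩ := hdust i u hu hnt ε hε
    exact ⟨v, ⟨hv, hvnt⟩, hd⟩

/-- **The pruned configuration is `Regular`** if the original has covering degree one, laminar winding interiors
and is locally finite, and its NON-POINT loops satisfy the boundary and separating properties. -/
theorem regular_prune {x : LoopConfig ℂ} (hlf : x.IsLocallyFinite)
    (hdeg : ∀ u ∈ x.loops, ∀ z : ℂ, u.wind z = 0 ∨ u.wind z = 1 ∨ u.wind z = -1)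
    (hlam : ∀ u ∈ x.loops, ∀ v ∈ x.loops,
      {z | u.wind z ≠ 0} ⊆ {z | v.wind z ≠ 0} ∨ {z | v.wind z ≠ 0} ⊆ {z | u.wind z ≠ 0} ∨
        Disjoint {z | u.wind z ≠ 0} {z | v.wind z ≠ 0})
    (hbd : ∀ u ∈ x.loops, u.range.Nontrivial → u.range = frontier {z | u.wind z ≠ 0})
    (hsep : ∀ u ∈ x.loops, ∀ v ∈ x.loops, u.range.Nontrivial → v.range.Nontrivial →
      {z | u.wind z ≠ 0} = {z | v.wind z ≠ 0} → u = v ∨ u = v.reverse) :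
    Regular (⟨fun i ↦ {u ∈ x.F i | u.range.Nontrivial}⟩ : LoopConfig ℂ) where
  locallyFinite := hlf.mono fun _ _ hu ↦ hu.1
  degreeOne u hu := hdeg u (loops_prune_subset x hu)
  boundary u hu := hbd u (loops_prune_subset x hu) (nontrivial_of_mem_loops_prune hu)
  laminar u hu v hv := hlam u (loops_prune_subset x hu) v (loops_prune_subset x hv)
  separating u hu v hv := hsep u (loops_prune_subset x hu) v (loops_prune_subset x hv)
    (nontrivial_of_mem_loops_prune hu) (nontrivial_of_mem_loops_prune hv)

end Precompact

open Precompact in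
/-- **T2m (regular modification) for a lattice ensemble from the two hard a.s. fields plus dust (registered
anchor).**  Let `E ∈ latticeEnsembles`, `δₖ → 0⁺`, and `X : [0,1] → C` a presentation of a sequential `d_CN`-limit
of the laws of `E.X δₖ` with measurable exceptional events.  Assume, for a.e. `s`: (B) every non-point loop of
`X s` has trace equal to the frontier of its winding interior; (S) two non-point loops of `X s` with equal winding
interiors coincide up to reversal; (D) every point loop of `X s` is a `udist`-limit of non-point loops of `X s` of
its type.  Then there is an a.e.-`Regular` presentation `X'` with `d_CN(X s, X' s) = 0` a.e. — namely the pruned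
configurations `(X s)⁺ = ⟨fun i ↦ {u ∈ (X s).F i | u.range.Nontrivial}⟩`: `degreeOne`, `laminar` (p129158) and local finiteness
(`ae_isLocallyFinite_of_tendsto_cnLawEDist`) hold a.s. for `X` itself and restrict to sub-configurations. -/
theorem regularModification_of_ae_boundary_separating : ∀ E ∈ latticeEnsembles, ∀ (δs : ℕ → ℝ)
    (X : unitInterval → LoopConfig ℂ), Tendsto δs atTop (𝓝[>] (0 : ℝ)) →
    (∀ (k : ℕ) (ε : ℝ), MeasurableSet {p : E.Ω × unitInterval | LoopConfig.IsClose ε (E.X (δs k) p.1) (X p.2)}) →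
    Tendsto (fun k : ℕ ↦ LoopConfig.cnLawEDist E.P (E.X (δs k)) volume X) atTop (𝓝 0) →
    (∀ᵐ s : unitInterval, ∀ u ∈ (X s).loops, u.range.Nontrivial → u.range = frontier {z | u.wind z ≠ 0}) →
    (∀ᵐ s : unitInterval, ∀ u ∈ (X s).loops, ∀ v ∈ (X s).loops, u.range.Nontrivial → v.range.Nontrivial →
      {z | u.wind z ≠ 0} = {z | v.wind z ≠ 0} → u = v ∨ u = v.reverse) →
    (∀ᵐ s : unitInterval, ∀ (i : Fin 2), ∀ u ∈ (X s).F i, ¬ u.range.Nontrivial → ∀ ε : ℝ, 0 < ε →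
      ∃ v ∈ (X s).F i, v.range.Nontrivial ∧ u.udist v ≤ ε) →
    ∃ X' : unitInterval → LoopConfig ℂ, (∀ᵐ s : unitInterval, Regular (X' s)) ∧
      ∀ᵐ s : unitInterval, LoopConfig.cnEDist (X s) (X' s) = 0 := by
  intro E hE δs X hδs hm h hbd hsep hdust
  refine ⟨fun s ↦ ⟨fun i ↦ {u ∈ (X s).F i | u.range.Nontrivial}⟩, ?_, ?_⟩
  · filter_upwards [ae_degreeOne_laminar_of_tendsto_cnLawEDist E hE δs volume X hδs hm h,
      ae_isLocallyFinite_of_tendsto_cnLawEDist E hE δs volume X hδs hm h, hbd, hsep] with s hdl hlf hb hs'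
    exact regular_prune hlf hdl.1 hdl.2 hb hs'
  · filter_upwards [hdust] with s hs
    exact cnEDist_prune_eq_zero hs

open Precompact in
/-- Law form: under the same three a.s. hypotheses the pruned presentation is a `d_CN`-limit along the same mesh
sequence (Lemma L, `Precompact.tendsto_cnLawEDist_of_ae_cnEDist_eq_zero`), i.e. the conclusion of T2m / T2'. -/
theorem regularLimit_of_ae_boundary_separating {E : LoopEnsemble} (hE : E ∈ latticeEnsembles) {δs : ℕ → ℝ}
    {X : unitInterval → LoopConfig ℂ} (hδs : Tendsto δs atTop (𝓝[>] (0 : ℝ)))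
    (hm : ∀ (k : ℕ) (ε : ℝ), MeasurableSet {p : E.Ω × unitInterval | LoopConfig.IsClose ε (E.X (δs k) p.1) (X p.2)})
    (h : Tendsto (fun k : ℕ ↦ LoopConfig.cnLawEDist E.P (E.X (δs k)) volume X) atTop (𝓝 0))
    (hbd : ∀ᵐ s : unitInterval, ∀ u ∈ (X s).loops, u.range.Nontrivial → u.range = frontier {z | u.wind z ≠ 0})
    (hsep : ∀ᵐ s : unitInterval, ∀ u ∈ (X s).loops, ∀ v ∈ (X s).loops, u.range.Nontrivial →
      v.range.Nontrivial → {z | u.wind z ≠ 0} = {z | v.wind z ≠ 0} → u = v ∨ u = v.reverse)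
    (hdust : ∀ᵐ s : unitInterval, ∀ (i : Fin 2), ∀ u ∈ (X s).F i, ¬ u.range.Nontrivial → ∀ ε : ℝ, 0 < ε →
      ∃ v ∈ (X s).F i, v.range.Nontrivial ∧ u.udist v ≤ ε) :
    ∃ X' : unitInterval → LoopConfig ℂ, (∀ᵐ s : unitInterval, Regular (X' s)) ∧
      Tendsto (fun k : ℕ ↦ LoopConfig.cnLawEDist E.P (E.X (δs k)) volume X') atTop (𝓝 0) := by
  haveI : IsProbabilityMeasure E.P := isProbabilityMeasure_of_mem hE
  obtain ⟨X', hreg, h0⟩ := regularModification_of_ae_boundary_separating E hE δs X hδs hm h hbd hsep hdust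
  exact ⟨X', hreg, tendsto_cnLawEDist_of_ae_cnEDist_eq_zero E.P (fun k ↦ E.X (δs k)) volume h0 h⟩

end Summit.CriticalPhenomena.CardyFormulaZ2.Cruxes.NestingRigidity.PositiveConeWeightDoubling

end
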